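import Summits.AtomisticToContinuum.Crystallization.Theorems.LayeredLawsSelectHcp.Negative.RootClause

/-!
# Negative knowledge for crux `LayeredLawsSelectHcp` (stmt-AtomisticToContinuum-9226), IX:
# H1 is redundant — good shells separate, the Mecke identity roots; the crux without H1

Part IX (`--supports stmt-AtomisticToContinuum-9226`). `dist_ge_of_goodShell`: a `(1/100)`-good shell at
`x ∈ S` (the per-point clause of H4) puts every other point of `S` at distance `≥ 891/1000 = 99/100 · 9/10`
from `x` (points inside the shell radius are `a/100`-matched to a rotated `a`-scaled UNIT pattern, points
outside are at `> 5a/4 ≥ 9/8`); `countable_nonempty_of_barlowLike`; **`rooted_of_pointStationary_layered`**: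
H2 ∧ H4 ⇒ H1 with `δ = 891/1000` (the root is a point by `RootClause.ae_zero_mem_of_pointStationary`);
hence **`crux_iff_without_rooted : LayeredLawsSelectHcp ↔ ∀ P, IsProbabilityMeasure P → PointStationary P
→ meanRootEnergy P ≤ e* → Layered P → ∀ᵐ μ ∂P, IsRelaxedHcp μ`** — the hypothesis H1 and the parameter `δ`
of the crux are decoration; a prover may drop them. All `[folklore]`.
-/

noncomputable section

namespace Summit.AtomisticToContinuum.Crystallization.Theorems.LayeredLawsSelectHcp.Negative.RootedRedundant

open MeasureTheory Set
open Literature.MathematicalPhysics.StatisticalMechanics Literature.Geometry.DiscreteGeometry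
open Summit.AtomisticToContinuum.Crystallization.Theses.PalmUnimodularRigidity (LayeredLawsSelectHcp)
open Summit.AtomisticToContinuum.Crystallization.Theorems.ChargedEnergyGapNegative
  (eStar eStar_le bddBelow_energyPerParticle_lennardJones)
open Summit.AtomisticToContinuum.Crystallization.Theorems.LayeredLawsSelectHcp.Negative.DiracLaws
open Summit.AtomisticToContinuum.Crystallization.Theorems.LayeredLawsSelectHcp.Negative.RootClause

/-- Euclidean `3`-space. [folklore] -/
local notation "E3" => EuclideanSpace ℝ (Fin 3)

/-! ## H1 is fully redundant: good shells separate, H2 roots; the crux without H1 -/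

/-- A point matched within `a/100` to a rotated, `a`-scaled unit pattern has norm `≥ 99a/100`. [folklore] -/
theorem norm_ge_of_etaMatched {a : ℝ} (ha : 0 ≤ a) {T P : Finset E3} (hP : ∀ q ∈ P, ‖q‖ = 1)
    {A : E3 →ₗᵢ[ℝ] E3}
    (h : EtaMatched (a / 100) T ((P.image fun v : E3 => a • v).image A)) {t : E3} (ht : t ∈ T) :
    99 / 100 * a ≤ ‖t‖ := by
  obtain ⟨e, he⟩ := h
  have hmem := (e ⟨t, ht⟩).2
  obtain ⟨p', hp', hq⟩ := Finset.mem_image.1 hmem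
  obtain ⟨q, hq0, rfl⟩ := Finset.mem_image.1 hp'
  have hnorm : ‖(e ⟨t, ht⟩ : E3)‖ = a := by
    rw [← hq, LinearIsometry.norm_map, norm_smul, hP q hq0, mul_one, Real.norm_of_nonneg ha]
  have hd : dist t (e ⟨t, ht⟩ : E3) ≤ a / 100 := he ⟨t, ht⟩
  rw [dist_eq_norm] at hd
  have := norm_sub_norm_le (e ⟨t, ht⟩ : E3) t
  rw [hnorm, ← norm_neg ((e ⟨t, ht⟩ : E3) - t), neg_sub] at this
  linarith

/-- **Good shells separate**: if `x ∈ S` has a `(1/100)`-good shell (H4) then every other point of `S`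
is at distance `≥ 891/1000` from `x` (`= 99/100 · 9/10`; points beyond the shell radius are at
`> 5a/4 ≥ 9/8`). [folklore] -/
theorem dist_ge_of_goodShell {S : Set E3} {x : E3} (h : GoodShell S x) {y : E3} (hy : y ∈ S)
    (hne : y ≠ x) : (891 / 1000 : ℝ) ≤ dist y x := by
  obtain ⟨a, h9, h1, T, hT, hclose⟩ := h
  by_cases hd : dist y x ≤ 5 / 4 * a
  · have hmem : y - x ∈ (↑T : Set E3) := by
      rw [hT]; exact ⟨y, ⟨hy, hne, hd⟩, rfl⟩
    have key : ∀ P : Finset E3, (∀ q ∈ P, ‖q‖ = 1) →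
        ShellCloseTo (a / 100) T (P.image fun v : E3 => a • v) → (891 / 1000 : ℝ) ≤ dist y x := by
      rintro P hP ⟨A, hA⟩
      have := norm_ge_of_etaMatched (by linarith) hP hA (Finset.mem_coe.1 hmem)
      rw [dist_eq_norm]
      linarith
    rcases hclose with hc | hc
    · exact key _ (fun q hq => norm_eq_one_of_mem_fccKissingPattern hq) hc
    · exact key _ (fun q hq => norm_eq_one_of_mem_hcpKissingPattern hq) hc
  · push Not at hd
    linarith

/-- A Barlow-like set is countable and non-empty. [folklore] -/
theorem countable_nonempty_of_barlowLike {S : Set E3} (h : BarlowLike S) : S.Countable ∧ S.Nonempty := by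
  obtain ⟨s, -, Φ, hbij, -⟩ := h
  have hc : (barlowStacking 1 (Real.sqrt (2 / 3)) s).Countable := by
    have : barlowStacking 1 (Real.sqrt (2 / 3)) s =
        Set.range fun t : ℤ × ℤ × ℤ => barlowPos 1 (Real.sqrt (2 / 3)) s t.1 t.2.1 t.2.2 := by
      ext z
      simp only [mem_barlowStacking_iff, Set.mem_range, Prod.exists]
      constructor <;> rintro ⟨k, i, j, h⟩ <;> exact ⟨k, i, j, h.symm⟩
    rw [this]
    exact Set.countable_range _
  refine ⟨?_, ?_⟩
  · rw [← hbij.image_eq]; exact hc.image _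
  · rw [← hbij.image_eq]; exact ⟨_, ⟨_, barlowPos_mem 0 0 0, rfl⟩⟩

/-- **H1 follows from H2 ∧ H4** (with `δ = 891/1000`): H4's shells give the separation
(`dist_ge_of_goodShell`) and H2 puts the root at a point (`ae_zero_mem_of_pointStationary`, §9).
[folklore] -/
theorem rooted_of_pointStationary_layered {P : Measure (Measure E3)} (h2 : PointStationary P)
    (h4 : Layered P) : Rooted (891 / 1000) P := by
  have hc : ∀ᵐ μ ∂P, ∃ S : Set E3, S.Countable ∧ μ = (Measure.count : Measure E3).restrict S := by
    filter_upwards [h4] with μ ⟨S, hμ, _, hbar⟩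
    exact ⟨S, (countable_nonempty_of_barlowLike hbar).1, hμ⟩
  filter_upwards [h4, ae_zero_mem_of_pointStationary h2 hc] with μ ⟨S, hμ, hshell, hbar⟩ h0
  obtain ⟨hSc, hSne⟩ := countable_nonempty_of_barlowLike hbar
  refine ⟨S, ?_, fun x hx y hy hne => ?_, hμ⟩
  · rcases h0 with h0 | h0
    · exfalso
      obtain ⟨z, hz⟩ := hSne
      have : μ {z} = 1 := by rw [hμ, count_restrict_singleton hz]
      rw [h0, Measure.coe_zero, Pi.zero_apply] at this
      exact zero_ne_one this
    · rw [hμ, Measure.restrict_apply (measurableSet_singleton 0)] at h0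
      by_contra h0S
      exact h0 (by rw [Set.singleton_inter_eq_empty.2 h0S, measure_empty])
  · rw [dist_comm]
    exact dist_ge_of_goodShell (hshell x hx) hy (Ne.symm hne)

/-- **The crux is equivalent to its version WITHOUT H1** (and hence independent of `δ`): a prover
may drop the rootedness/separation hypothesis altogether. [folklore] -/
theorem crux_iff_without_rooted :
    LayeredLawsSelectHcp ↔
      ∀ P : Measure (Measure E3), IsProbabilityMeasure P → PointStationary P →
        meanRootEnergy P ≤ eStar → Layered P → ∀ᵐ μ ∂P, IsRelaxedHcp μ := by
  rw [crux_iff]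
  constructor
  · intro H P hP h2 h3 h4
    exact H (891 / 1000) (by norm_num) P hP (rooted_of_pointStationary_layered h2 h4) h2 h3 h4
  · intro H δ _ P hP _ h2 h3 h4
    exact H P hP h2 h3 h4

end Summit.AtomisticToContinuum.Crystallization.Theorems.LayeredLawsSelectHcp.Negative.RootedRedundant

end
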